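import Summits.ValiantsHypothesis.ValiantsHypothesis.Theorems.KPlusLogSqLawTropicalBStaticPortsDefs

/-!
# Route `KPlusLogSqLaw`, crux `TropicalB` — the STATIC (PORT) EMBEDDING, part 2: class switches are permutation changes

HONEST FRAMING.  Support file toward the registered stubs `stub_tropThin` / `stub_tropFat` of the crux `TropicalB`
(ledger item `stmt-ValiantsHypothesis-19771`, route `KPlusLogSqLaw`; cell `pub-symmetroid`, seat val-sym-trop-p4, 2026-08-26).
It proves NEITHER stub and no census row.  It proves a structural EQUIVALENCE between the general tropical row and the
static one (`TropRootLawAtStatic`, tree part 4): the converse of the tree's static reduction `tropRootLawAt_of_static`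
WITHOUT loss in the bound, at the price of the size `m ↦ m·K`.  Nothing is asserted about `TropicalB` inside its window,
`Lifting`, `KPlusLogSqLaw`, `MatrixDescartes` or `VP ≠ VNP`.

THE LEMMA (`tropRootLawAt_of_static_ports`).  `TropRootLawAtStatic (m * K) K B → TropRootLawAt m K B` for all `m K B`.
Hence the static capacity `S(M, K)` (signed breakpoints of the K-slope parametric ASSIGNMENT problem on `M` nodes) and the
general capacity `T(m, K)` satisfy `T(m, K) ≤ S(m·K, K)` as well as the tree's `T(m,K) + 1 ≤ (m²(K−1)+1)(S(m,K)+1)`: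
the two have the same growth exponents in the size at every fixed `K`, and «class switches at a fixed permutation»
(≤ `m²(K−1)` of them in any chain, `…TropicalPermutationChanges`) carry NO obstruction — every switch mechanism is a swap
mechanism at `K`-fold size.  Example: the cell's counting-tight `K = 3` family SHIFT-THREE (`C(m+2,2) − 1` terms, `m − 1`
permutation changes) becomes a STATIC `(3m, 3)` family with the same chain, so `S(3m, 3) ≥ C(m+2,2) − 1` (quadratic).

CONSTRUCTION (definitions in part 1, `…TropicalBStaticPortsDefs`; «ports», star form; `K = K' + 1`, hub `= Fin.last K'`).  Index rows and columns of the big matrix by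
`Fin m × Fin (K'+1)` (transported to `Fin (m·K)` by `finProdFinEquiv`).  Column `(j, l)` = PORT `l` of group `j` (the hub is
port `last`); row `(i, last)` = ORIGINAL row `i`; row `(j, t)`, `t ≠ last` = AUX row `t` of group `j`.  Entries: original row
`i` to port `(j, l)` carries class `l` with the original `(v, ε)` of `(i, j, l)`; aux row `(j, t)` to its own port `(j, t)`:
class `0`, `v = 0`, `ε = +1`; aux row `(j, t)` to the hub `(j, last)`: class `0`, `v = 0`, `ε = −1`; nothing else.  A
present perfect matching leaves exactly one port per group to an original row, so present big terms ↔ original terms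
`(σ, λ)`: `Σ(σ, λ) = rowperm σ ∘ colperm λ` with `rowperm σ = prodCongrLeft (σ on the slot `last`)` and
`colperm λ = prodCongrRight (j ↦ swap last (λ j))`; weights shift uniformly by `θ·m·K'·d 0`, and the sign bookkeeping
`sign (swap last (λ j))` is cancelled exactly by the hub sign `−1`, so `termSign` is preserved on the nose.

[folklore] (gadget: parallel classes → ports with a star of auxiliary rows).
-/

-- `Summit.ValiantsHypothesis.ValiantsHypothesis.…` repeats a component by the D-0017 layout
-- (single-conjunct summit), which the `dupNamespace` linter flags; the name is mandated.
set_option linter.dupNamespace false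
set_option autoImplicit false

namespace Summit.ValiantsHypothesis.ValiantsHypothesis.Theorems.LacunarySymmetroidMatrixDescartes.TropicalCensus

open Summit.ValiantsHypothesis.ValiantsHypothesis.Theorems.MatrixDescartes.Negative
open Finset

namespace StaticPorts

variable {m K' : ℕ}

/-! ## 1. Weight and sign of the image term -/

/-- **weights**: the image term has the original tropical weight shifted by the uniform amount `θ·m·K'·d 0`. -/
theorem tropWeight_bigTerm (d : Fin (K' + 1) → ℕ) (v : Fin m → Fin m → Fin (K' + 1) → ℤ) (θ : ℤ)
    (p : Equiv.Perm (Fin m) × (Fin m → Fin (K' + 1))) :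
    tropWeight d (bigV v) θ (bigTerm p) = tropWeight d v θ p + θ * (m * K' * d 0 : ℕ) := by
  unfold tropWeight bigTerm bigV
  simp only
  rw [← Equiv.sum_comp finProdFinEquiv (fun y => (d (portCls p.2 (finProdFinEquiv.symm y)) : ℤ)),
    ← Equiv.sum_comp finProdFinEquiv (fun y => portV v (finProdFinEquiv.symm
      ((finProdFinEquiv.permCongr (portPerm p.1 p.2)) y)) (finProdFinEquiv.symm y)
      (portCls p.2 (finProdFinEquiv.symm y)))]
  simp only [Equiv.permCongr_apply, Equiv.symm_apply_apply]
  rw [Fintype.sum_prod_type, Fintype.sum_prod_type]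
  simp only [portV_portPerm]
  have h1 : ∀ j : Fin m, ∑ l' : Fin (K' + 1), (d (portCls p.2 (j, l')) : ℤ) = (d (p.2 j) : ℤ) + K' * (d 0 : ℤ) := by
    intro j
    unfold portCls
    simp only
    rw [← sum_ite_eq_add (p.2 j) (d (p.2 j) : ℤ) (d 0 : ℤ)]
    refine sum_congr rfl fun l' _ => ?_
    split_ifs with h
    · rw [h]
    · rfl
  have h2 : ∀ j : Fin m, ∑ l' : Fin (K' + 1), (if l' = p.2 j then v (p.1 j) j (p.2 j) else 0) = v (p.1 j) j (p.2 j) := by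
    intro j
    rw [sum_ite_eq' univ (p.2 j), if_pos (mem_univ _)]
  simp only [h1, h2, sum_add_distrib, sum_const, card_univ, Fintype.card_fin]
  push_cast
  ring

/-- **signs**: the image term has exactly the original term sign (the swap signs cancel against the hub signs). -/
theorem termSign_bigTerm (ε : Fin m → Fin m → Fin (K' + 1) → ℤ) (p : Equiv.Perm (Fin m) × (Fin m → Fin (K' + 1))) :
    termSign (bigE ε) (bigTerm p) = termSign ε p := by
  unfold termSign bigTerm bigE
  simp only
  rw [Equiv.Perm.sign_permCongr, sign_portPerm]
  rw [← Equiv.prod_comp finProdFinEquiv (fun y => portE ε (finProdFinEquiv.symm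
      ((finProdFinEquiv.permCongr (portPerm p.1 p.2)) y)) (finProdFinEquiv.symm y)
      (portCls p.2 (finProdFinEquiv.symm y)))]
  simp only [Equiv.permCongr_apply, Equiv.symm_apply_apply]
  rw [Fintype.prod_prod_type]
  simp only [portE_portPerm, prod_ite_ite_eq, prod_mul_distrib]
  have hsq : (∏ j : Fin m, (if p.2 j = Fin.last K' then (1 : ℤ) else -1)) *
      (∏ j : Fin m, (if p.2 j = Fin.last K' then (1 : ℤ) else -1)) = 1 := by
    rw [← prod_mul_distrib]
    refine prod_eq_one fun j _ => ?_
    split_ifs <;> norm_num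
  calc (Equiv.Perm.sign p.1 : ℤ) * (∏ j : Fin m, (if p.2 j = Fin.last K' then (1 : ℤ) else -1)) *
        ((∏ j : Fin m, ε (p.1 j) j (p.2 j)) * ∏ j : Fin m, (if p.2 j = Fin.last K' then (1 : ℤ) else -1))
      = (Equiv.Perm.sign p.1 : ℤ) * (∏ j : Fin m, ε (p.1 j) j (p.2 j)) *
        ((∏ j : Fin m, (if p.2 j = Fin.last K' then (1 : ℤ) else -1)) *
          ∏ j : Fin m, (if p.2 j = Fin.last K' then (1 : ℤ) else -1)) := by ring
    _ = (Equiv.Perm.sign p.1 : ℤ) * ∏ j : Fin m, ε (p.1 j) j (p.2 j) := by rw [hsq, mul_one]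

/-! ## 2. Every present big term is an image term -/

/-- case analysis of a present big entry -/
theorem portE_ne_zero_cases (ε : Fin m → Fin m → Fin (K' + 1) → ℤ) (r c : Fin m × Fin (K' + 1)) (l : Fin (K' + 1))
    (h : portE ε r c l ≠ 0) :
    (r.2 = Fin.last K' ∧ l = c.2) ∨ (r.2 ≠ Fin.last K' ∧ c.1 = r.1 ∧ l = 0 ∧ (c.2 = r.2 ∨ c.2 = Fin.last K')) := by
  unfold portE at h
  split_ifs at h with h1 h2 h3 h4 h5
  · exact Or.inl ⟨h1, h2⟩
  · exact absurd rfl h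
  · exact Or.inr ⟨h1, h3.1, h3.2, Or.inl h4⟩
  · exact Or.inr ⟨h1, h3.1, h3.2, Or.inr h5⟩
  · exact absurd rfl h
  · exact absurd rfl h

/-- **surjectivity onto present terms**: a big term all of whose entries are present is the image of an original term. -/
theorem exists_bigTerm_eq (ε : Fin m → Fin m → Fin (K' + 1) → ℤ)
    (q : Equiv.Perm (Fin (m * (K' + 1))) × (Fin (m * (K' + 1)) → Fin (K' + 1)))
    (hq : termSign (bigE ε) q ≠ 0) : ∃ p, bigTerm p = q := by
  -- the structured form of `q`
  set e : Fin m × Fin (K' + 1) ≃ Fin (m * (K' + 1)) := finProdFinEquiv with he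
  set S : Equiv.Perm (Fin m × Fin (K' + 1)) := e.symm.permCongr q.1 with hS
  set L : Fin m × Fin (K' + 1) → Fin (K' + 1) := fun u => q.2 (e u) with hL
  have hSu : ∀ u, S u = e.symm (q.1 (e u)) := by
    intro u; rw [hS, Equiv.permCongr_apply, Equiv.symm_symm]
  have hpres : ∀ u, portE ε (S u) u (L u) ≠ 0 := by
    intro u
    have := present_of_termSign_ne_zero (bigE ε) q hq (e u)
    unfold bigE at this
    rw [← he, Equiv.symm_apply_apply] at this
    rw [hSu]
    exact this
  have hcase : ∀ u, ((S u).2 = Fin.last K' ∧ L u = u.2) ∨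
      ((S u).2 ≠ Fin.last K' ∧ u.1 = (S u).1 ∧ L u = 0 ∧ (u.2 = (S u).2 ∨ u.2 = Fin.last K')) :=
    fun u => portE_ne_zero_cases ε (S u) u (L u) (hpres u)
  -- the free port and the original row of each group
  set lam : Fin m → Fin (K' + 1) := fun j => (S (j, Fin.last K')).2 with hlam
  -- Claim C: if the hub is not free, the aux row `(j, λ j)` sits on it
  have hC : ∀ j, lam j ≠ Fin.last K' → S (j, Fin.last K') = (j, lam j) := by
    intro j hj
    rcases hcase (j, Fin.last K') with ⟨h1, _⟩ | ⟨_, h2, _, _⟩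
    · exact absurd h1 hj
    · exact Prod.ext h2.symm rfl
  -- Claim A: the row at the free port is an original row
  have hA : ∀ j, (S (j, lam j)).2 = Fin.last K' := by
    intro j
    by_cases hj : lam j = Fin.last K'
    · rw [hj]; exact hj
    · rcases hcase (j, lam j) with ⟨h1, _⟩ | ⟨h1, h2, _, h4⟩
      · exact h1
      · exfalso
        rcases h4 with h4 | h4
        · -- then `S (j, λ j) = (j, λ j) = S (j, last)`
          have : S (j, lam j) = S (j, Fin.last K') := by
            rw [hC j hj]; exact Prod.ext h2.symm h4.symm
          exact hj (congrArg Prod.snd (S.injective this))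
        · exact hj h4
  -- Claim B: every other non-hub port carries its own aux row
  have hB : ∀ j l', l' ≠ lam j → l' ≠ Fin.last K' → S (j, l') = (j, l') := by
    intro j l' h1 h2
    rcases hcase (j, l') with ⟨h3, _⟩ | ⟨_, h4, _, h6⟩
    · -- an original row at `(j, l')`: where is the aux row `(j, l')`?
      exfalso
      obtain ⟨u₀, hu₀⟩ := S.surjective (j, l')
      rcases hcase u₀ with ⟨h7, _⟩ | ⟨_, h8, _, h9⟩
      · rw [hu₀] at h7; exact h2 h7
      · rw [hu₀] at h8 h9
        simp only at h8 h9
        rcases h9 with h9 | h9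
        · -- `u₀ = (j, l')`
          have : u₀ = (j, l') := Prod.ext h8 h9
          rw [this] at hu₀
          rw [hu₀] at h3
          exact h2 h3
        · -- `u₀ = (j, last)`, so `λ j = l'`
          have : u₀ = (j, Fin.last K') := Prod.ext h8 h9
          rw [this] at hu₀
          exact h1 (by rw [hlam]; simp only; rw [hu₀])
    · rcases h6 with h6 | h6
      · exact Prod.ext h4.symm h6.symm
      · exact absurd h6 h2
  -- the original permutation
  set σf : Fin m → Fin m := fun j => (S (j, lam j)).1 with hσf
  have hSfree : ∀ j, S (j, lam j) = (σf j, Fin.last K') := fun j => Prod.ext rfl (hA j)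
  have hinj : Function.Injective σf := by
    intro j₁ j₂ h
    have : S (j₁, lam j₁) = S (j₂, lam j₂) := by rw [hSfree, hSfree, h]
    exact congrArg Prod.fst (S.injective this)
  let σ : Equiv.Perm (Fin m) := Equiv.ofBijective σf ⟨hinj, Finite.surjective_of_injective hinj⟩
  have hσ : ∀ j, σ j = σf j := fun j => rfl
  -- the big permutation of `(σ, λ)` is `S`
  have hperm : ∀ u, portPerm σ lam u = S u := by
    rintro ⟨j, l'⟩
    rw [portPerm_apply]
    by_cases h1 : l' = lam j
    · rw [if_pos h1, h1, hSfree, hσ]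
    · rw [if_neg h1]
      by_cases h2 : l' = Fin.last K'
      · rw [if_pos h2, h2, hC j (fun h => h1 (h2.trans h.symm))]
      · rw [if_neg h2, hB j l' h1 h2]
  refine ⟨(σ, lam), Prod.ext ?_ ?_⟩
  · -- permutations
    unfold bigTerm
    ext y
    simp only [Equiv.permCongr_apply]
    rw [← he, hperm, hSu, Equiv.apply_symm_apply, Equiv.apply_symm_apply]
  · -- class maps
    unfold bigTerm
    funext y
    simp only
    rw [← he]
    have hy : q.2 y = L (e.symm y) := by rw [hL]; simp only; rw [Equiv.apply_symm_apply]
    rw [hy]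
    set u := e.symm y
    unfold portCls
    by_cases h1 : u.2 = lam u.1
    · rw [if_pos h1]
      rcases hcase u with ⟨_, h2⟩ | ⟨h2, _⟩
      · exact h2.symm
      · exfalso; apply h2
        have : S u = S (u.1, lam u.1) := by rw [← h1]
        rw [this, hSfree]
    · rw [if_neg h1]
      rcases hcase u with ⟨h2, _⟩ | ⟨_, _, h3, _⟩
      · exfalso
        have hu : S u = portPerm σ lam (u.1, u.2) := (hperm u).symm
        rw [hu] at h2
        exact h1 ((portPerm_snd_eq_last_iff σ lam u.1 u.2).mp h2)
      · exact h3.symm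

end StaticPorts

/-! ## 3. The embedding theorem -/

open StaticPorts in
/-- **STATIC (PORT) EMBEDDING.**  The static tropical row at size `m·K` implies the general tropical row at size `m` with
the SAME bound: `TropRootLawAtStatic (m * K) K B → TropRootLawAt m K B`.  Every dominant sign-alternating chain of a
general `(m, K)` design is, term by term, a dominant sign-alternating chain of the static `(m·K, K)` port design
(`tropWeight_bigTerm`: uniform shift; `termSign_bigTerm`: equal signs; `exists_bigTerm_eq`: every present big term is
an image).  Converse direction of the tree's `tropRootLawAt_of_static` (which costs the factor `m²(K−1)+1`); together:
static and general capacities have the same growth in the size at every fixed `K`. [folklore] -/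
theorem tropRootLawAt_of_static_ports (m K B : ℕ) (h : TropRootLawAtStatic (m * K) K B) : TropRootLawAt m K B := by
  rcases K with _ | K'
  · exact tropRootLawAt_zero m B
  intro d v ε n θ p hε hθ hdom halt
  refine h d (bigV v) (bigE ε) n θ (fun k => bigTerm (p k)) (bigE_natAbs_le ε hε) (bigE_static ε) hθ ?_ ?_
  · intro k
    refine ⟨?_, ?_⟩
    · rw [termSign_bigTerm]; exact (hdom k).1
    · intro q' hne hq'
      obtain ⟨p', rfl⟩ := exists_bigTerm_eq ε q' hq'
      have hne' : p' ≠ p k := fun h => hne (by rw [h])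
      have hp' : termSign ε p' ≠ 0 := by rwa [termSign_bigTerm] at hq'
      rw [tropWeight_bigTerm, tropWeight_bigTerm]
      have := (hdom k).2 p' hne' hp'
      linarith
  · intro k
    simp only [termSign_bigTerm]
    exact halt k

end Summit.ValiantsHypothesis.ValiantsHypothesis.Theorems.LacunarySymmetroidMatrixDescartes.TropicalCensus
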